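import Literature.NumberTheory.LFunctions.Zhang2022.DHChainBarrier
import Literature.NumberTheory.LFunctions.RepulsiveLogFreeDensitySingleModulus
import Literature.NumberTheory.LFunctions.ExplicitPNTNonExceptionalModuli
import HarnessLib

/-!
# Zhang (2022), rung F-S3, family B-dh: the PRIME-SIDE rows (P7) and structural row S5 of the explicit-chain
# menu over the (A)-world — statement `Zhang2022.DH.MenuConsistentPrimes` (companion of `DHChainBarrier`)

Y. Zhang, *Discrete mean estimates and the Landau–Siegel zero*, arXiv:2211.02515v1 [Zhang2022LandauSiegel] — an unrefereed
manuscript under adjudication. **The programme SEARCHES and TYPES; no claim about Landau–Siegel zeros, Theorems 1–2 of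
arXiv:2211.02515 or a repaired Margin232 until a kernel theorem says so.** Cell `landau-siegel`, B-dh/KILL-draft.md v1.2 §2 P7
and S5 (REF-B3 A3: ONE prime-count datum, every prime row checked against it WITHIN its printed error term; A4: structural
rows). `DHChainBarrier.lean` renders the zero/value rows; this file adds the prime rows. Nothing here is a theorem about
primes; `MenuConsistentPrimes` is a TARGET (§E), a bare `Prop` asserted by no one.

## What is typed

* `PrimeWorld` — prime-count data: `theta q a x h` ("`θ(x; q, a, h) = Σ_{x−h<p≤x, p≡a (q)} log p`", the object of
  `ThornerZaman2024PNTAP.thetaShortAP`); the long-interval `ψ(x; q, a)` datum is `ZeroWorld.psi` of `DHChainBarrier`.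
* `ZeroWorld.exceptionalPair` = `ThornerZaman2024PNTAP.ExceptionalPair` over the zero world (`χ₁ ≠ 1`, quadratic,
  `1 − 1/(50 log q) ≤ β₁ < 1`, `β₁` a zero of slot `(q, χ₁)`).
* `PrimeMenu w p : Prop` — a STRUCTURE, one field per typed prime row, verbatim on the data (R5): `rowP1` ↔
  `BMOR2018.lemma612_psi` (both clauses; the "no exceptional zero" hypothesis of clause 2 read over `w`); `rowP2`/`rowP3` ↔
  `thornerZaman2024PNTAP_theorem1_regular` / `_exceptional`; `rowP4`/`rowP5` ↔ `thornerZaman2024PNTAP_corollary5_regular` /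
  `_exceptional`; `rowP6` ↔ `xylouris2011_theorem21` (Linnik `P(q) ≤ Cq⁵`, read as: the `θ`-count of the class on `(0, Cq⁵]` is
  positive); `rowS5` (A4): additivity `Σ_{a mod q} θ(x;q,a,h) = θ(x;1,0,h)`, `θ ≥ 0` and non-decreasing in `h`
  (`0 ≤ h ≤ h' ≤ x`), `ψ(x;q,a) ≥ 0` and non-decreasing in `x` (`3 ≤ x ≤ x'`).
* OUTSIDE the rendered prime menu, by id (scope rule of `DHChainBarrier`: any further row re-opens the certificate):
  Brun–Titchmarsh rows (Montgomery–Vaughan `2x/(φ(q) log(x/q))` is not a tree decl; `Shiu1980BrunTitchmarsh` concerns general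
  multiplicative functions), `wright2023_brunTitchmarsh_exceptional`, the Linnik-box rows `xylouris2011_theorem23/24` (zero
  rows with `∃q₀`), `thornerZaman2024PNTAP_theorem7_repulsive` (`∃C`), prime-power bookkeeping (`ψ − θ`), and the UniformABC row.
* THE PRIME (A)-WORLD `primeWorld D χ` (KILL-draft §3 P7): with `β₁ = betaExc D` and the sign `s(q,a) := Re ψ(a)` for the
  character `ψ` mod `q` induced from `χ` when `D ∣ q` (`0` otherwise):
  `θ_W(x; q, a, h) := (1/φ(q)) ∫_{max(x−h,1)}^{max(x,1)} (1 − s(q,a) t^{β₁−1}) dt` for units `a`, `0` for non-units — the Siegel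
  main term of Thorner–Zaman's Theorem 1 (their `λ·h/φ(q)`), cut off below `t = 1` so that `θ_W ≥ 0` and is monotone.

## Why each prime row holds in `W` (road map for §E; `𝓛 = log D ≥ 43 250`, `δ = 1 − β₁ = (2/3)𝓛^{−2022}`, induced `q ≥ D`)

rowP1: `|ψ_W − x/φ| = x^{β₁}/(β₁φ(q))` on induced `q`, else `0`; clause 1 since `β₁ ≤ 1 − 40/(√q log²q)` and `1/β₁ ≤ 1.012`;
clause 2: its hypothesis fails while `δ ≤ 1/(R₁ log q)`, and once `δ > 1/(R₁ log q)`, `x ≥ e^{4R₁ log²q}` gives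
`x^{−δ} ≤ e^{−u²/log q} ≤ e^{−2u}` (`u = √(log x/R₁) ≥ 2 log q`) `≪ 1.4579√u e^{−u}`. rowP2/P4 (no exceptional pair at `q`): either
`D ∤ q` (`θ_W = (x − max(x−h,1))/φ`, error `≤ 1/φ(q) ≤ (h/φ)·h^{−1}`) or `δ > 1/(50 log q)` and then the relative error
`≤ 1/h + h^{β₁−1}/β₁ ≤ 3h^{−δ} ≤ 3e^{−(7/600) log x/log q} ≤ 3e^{−(7/600) log x/errDenom}` (`h ≥ x^{7/12}`, `errDenom ≥ log q`):
`c = 7/600`, `K = 3` (`c = 1/50`, `K = 5` for Corollary 5). rowP3/P5 (exceptional pair = the induced `ψ` with `β₁`): `θ_W` IS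
the printed main term when `x − h ≥ 1`, and differs by `≤ 2.1/φ(q)` otherwise, against an allowance `≥ K x^{0.9}` (`x ≥ h ≥ φ(q)`).
rowP6: `θ_W(X;q,a,X) = (1/φ)∫_1^X (1 − s t^{−δ}) dt > 0` for `X > 1`: `C = 2`. rowS5: the integrand is `≥ 0` on `t ≥ 1`;
additivity from `Σ_{a ∈ (ℤ/q)ˣ} ψ(a) = 0` (`ψ ≠ χ₀`) and `#(ℤ/q)ˣ = φ(q)`; `ψ_W(x) = (x − s x^{β₁}/β₁)/φ` is `≥ 0` and increasing
for `x ≥ 3` (`δ log 3 ≥ −log(1 − δ)`).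
-/

noncomputable section

open scoped Classical
open Complex

namespace Literature.NumberTheory.LFunctions.Zhang2022.DH

open ThornerZaman2024PNTAP

/-! ## 1. Prime-count data and the exceptional pair over a world -/

/-- PRIME-COUNT DATA: `theta q a x h` = "`Σ_{x−h<p≤x, p≡a (mod q)} log p`" (the object `thetaShortAP` of the tree).
[cite: ThornerZaman2024PNTAP, Theorem 1 p.3] -/
structure PrimeWorld where
  /-- `θ(x; q, a, h)` -/
  theta : (q : ℕ) → ZMod q → ℝ → ℝ → ℝ

/-- `ThornerZaman2024PNTAP.ExceptionalPair χ₁ β₁` over the world: `χ₁ ≠ χ₀` quadratic with a real zero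
`β₁ ∈ [1 − 1/(50 log q), 1)` of slot `(q, χ₁)`. [cite: ThornerZaman2024PNTAP, §1 (β₁,χ₁) p.2] -/
def ZeroWorld.exceptionalPair (w : ZeroWorld) {q : ℕ} (χ₁ : DirichletCharacter ℂ q) (β₁ : ℝ) : Prop :=
  χ₁ ≠ 1 ∧ χ₁.IsQuadratic ∧ 1 - 1 / (50 * Real.log q) ≤ β₁ ∧ β₁ < 1 ∧ w.IsZero q χ₁ β₁

/-! ## 2. The prime menu: one field per typed prime row, verbatim over the data -/

/-- **THE PRIME MENU** — one field per typed prime-side row (module docstring: field ↔ tree decl), plus the structural row S5.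
SCOPE: prime menu = these rows as rendered; any further prime row re-opens the certificate. [cite: Zhang2022LandauSiegel, §2 Assumption (A)] -/
structure PrimeMenu (w : ZeroWorld) (p : PrimeWorld) : Prop where
  /-- P7/BMOR = `BMOR2018.lemma612_psi` on `w.psi` (residue `a.val`), clause 2's "no exceptional zero" over `w`. -/
  rowP1 : ∀ (q : ℕ) [NeZero q], 10 ^ 5 ≤ q → ∀ (a : (ZMod q)ˣ) (x : ℝ),
    Real.exp (4 * BMOR2018.R₁ * Real.log q ^ 2) ≤ x →
      |w.psi q (a : ZMod q).val x - x / q.totient| ≤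
          1.012 / q.totient * x ^ (1 - 40 / (Real.sqrt q * Real.log q ^ 2)) + BMOR2018.errTerm x ∧
      ((∀ χ : DirichletCharacter ℂ q, χ.IsQuadratic →
          ∀ β : ℝ, 1 - 1 / (BMOR2018.R₁ * Real.log q) ≤ β → β < 1 → ¬ w.IsZero q χ β) →
        |w.psi q (a : ZMod q).val x - x / q.totient| ≤ BMOR2018.errTerm x)
  /-- P7/TZ1 = `thornerZaman2024PNTAP_theorem1_regular` on `p.theta`. -/
  rowP2 : ∀ ε : ℝ, 0 < ε → ε < 1 - 7 / 12 → ∃ c : ℝ, 0 < c ∧ ∃ K : ℝ, 0 ≤ K ∧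
    ∀ (q : ℕ) [NeZero q], 2 ≤ q → (∀ (χ₁ : DirichletCharacter ℂ q) (β₁ : ℝ), ¬ w.exceptionalPair χ₁ β₁) →
      ∀ (a : ZMod q), IsUnit a → ∀ (x h : ℝ), 4 ≤ h → h ≤ x → x ^ (7 / 12 + ε) ≤ h / Nat.totient q →
        |p.theta q a x h - h / Nat.totient q| ≤ K * (h / Nat.totient q) * Real.exp (-c * Real.log x / errDenom q x h)
  /-- P7/TZ1' = `thornerZaman2024PNTAP_theorem1_exceptional` on `p.theta` (`lambdaExc` of the tree). -/
  rowP3 : ∀ ε : ℝ, 0 < ε → ε < 1 - 71 / 75 → ∃ c : ℝ, 0 < c ∧ ∃ K : ℝ, 0 ≤ K ∧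
    ∀ (q : ℕ) [NeZero q], 2 ≤ q → ∀ (χ₁ : DirichletCharacter ℂ q) (β₁ : ℝ), w.exceptionalPair χ₁ β₁ →
      ∀ (a : ZMod q), IsUnit a → ∀ (x h : ℝ), 4 ≤ h → h ≤ x →
        x ^ (71 / 75 + ε) ≤ lambdaExc χ₁ β₁ a x h * h / Nat.totient q →
          |p.theta q a x h - lambdaExc χ₁ β₁ a x h * h / Nat.totient q| ≤
            K * (lambdaExc χ₁ β₁ a x h * h / Nat.totient q) * Real.exp (-c * Real.log x / errDenom q x h)
  /-- P7/TZ5 = `thornerZaman2024PNTAP_corollary5_regular` on `p.theta` (`h = x`). -/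
  rowP4 : ∃ c : ℝ, 0 < c ∧ ∃ K : ℝ, 0 ≤ K ∧
    ∀ (q : ℕ) [NeZero q], 2 ≤ q → (∀ (χ₁ : DirichletCharacter ℂ q) (β₁ : ℝ), ¬ w.exceptionalPair χ₁ β₁) →
      ∀ (a : ZMod q), IsUnit a → ∀ x : ℝ, 3 ≤ x → x ^ ((18 : ℝ) / 19) ≤ x / Nat.totient q →
        |p.theta q a x x - x / Nat.totient q| ≤
          K * (x / Nat.totient q) *
            (Real.exp (-c * Real.log x / Real.log q) +
              Real.exp (-c * Real.log x ^ ((3 : ℝ) / 5) / Real.log (Real.log x) ^ ((1 : ℝ) / 5)))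
  /-- P7/TZ5' = `thornerZaman2024PNTAP_corollary5_exceptional` on `p.theta`. -/
  rowP5 : ∃ c : ℝ, 0 < c ∧ ∃ K : ℝ, 0 ≤ K ∧
    ∀ (q : ℕ) [NeZero q], 2 ≤ q → ∀ (χ₁ : DirichletCharacter ℂ q) (β₁ : ℝ), w.exceptionalPair χ₁ β₁ →
      ∀ (a : ZMod q), IsUnit a → ∀ x : ℝ, 3 ≤ x →
        x ^ ((18 : ℝ) / 19) ≤ (1 - (χ₁ a).re * x ^ (β₁ - 1) / β₁) * x / Nat.totient q →
          |p.theta q a x x - (1 - (χ₁ a).re * x ^ (β₁ - 1) / β₁) * x / Nat.totient q| ≤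
            K * ((1 - (χ₁ a).re * x ^ (β₁ - 1) / β₁) * x / Nat.totient q) *
              (Real.exp (-c * Real.log x / Real.log q) +
                Real.exp (-c * Real.log x ^ ((3 : ℝ) / 5) / Real.log (Real.log x) ^ ((1 : ℝ) / 5)))
  /-- P7/Linnik = `xylouris2011_theorem21` (`P(q) ≤ C q⁵`), read on the data: the class `a` has positive `θ`-count on
  `(0, Cq⁵]`. -/
  rowP6 : ∃ C : ℝ, 0 < C ∧ ∀ (q : ℕ) [NeZero q], 1 ≤ q → ∀ a : ZMod q, IsUnit a →
    0 < p.theta q a (C * (q : ℝ) ^ (5 : ℕ)) (C * (q : ℝ) ^ (5 : ℕ))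
  /-- S5 (A4): additivity over residue classes, non-negativity and monotonicity of `θ` in `h` and of `ψ` in `x`. -/
  rowS5 : (∀ (q : ℕ) [NeZero q] (x h : ℝ), ∑ a : ZMod q, p.theta q a x h = p.theta 1 0 x h) ∧
    (∀ (q : ℕ) [NeZero q] (a : ZMod q) (x h h' : ℝ), 0 ≤ h → h ≤ h' → h' ≤ x →
      0 ≤ p.theta q a x h ∧ p.theta q a x h ≤ p.theta q a x h') ∧
    (∀ (q : ℕ) [NeZero q] (a : ℕ) (x x' : ℝ), 3 ≤ x → x ≤ x' → 0 ≤ w.psi q a x ∧ w.psi q a x ≤ w.psi q a x')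

/-! ## 3. The prime (A)-world -/

/-- The sign `s(q,a) := Re ψ(a)` of the character `ψ` mod `q` induced from `χ` when `D ∣ q`, and `0` when `D ∤ q`.
[cite: ThornerZaman2024PNTAP, Theorem 1 (definition of λ) p.3] -/
def siegelSign (D : ℕ) (χ : DirichletCharacter ℂ D) (q : ℕ) (a : ZMod q) : ℝ :=
  if h : D ∣ q then ((DirichletCharacter.changeLevel h χ) a).re else 0

/-- **The prime (A)-world**: `θ_W(x;q,a,h) = (1/φ(q)) ∫_{max(x−h,1)}^{max(x,1)} (1 − s(q,a) t^{β₁−1}) dt` on units `a`, `0` on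
non-units. [cite: ThornerZaman2024PNTAP, Theorem 1 (1.4) p.3] -/
def primeWorld (D : ℕ) (χ : DirichletCharacter ℂ D) : PrimeWorld where
  theta q a x h :=
    if IsUnit a then
      (∫ t in max (x - h) 1..max x 1, (1 - siegelSign D χ q a * t ^ (betaExc D - 1))) / Nat.totient q
    else 0

/-! ## 4. The prime-side certificate statement -/

/-- **`MenuConsistentPrimes` (B-DH-W, prime side; TARGET, proof → §E).** For every modulus `D` with `log D ≥ 43 250` and
every primitive quadratic `χ ≠ χ₀` mod `D`, the (A)-world `world D χ` with the prime data `primeWorld D χ` satisfies the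
rendered prime menu. Conjoined with `MenuConsistent` it is the certificate of KILL-draft §1 for the rows rendered in the two
files; any further row re-opens it. [cite: Zhang2022LandauSiegel, §2 Assumption (A)] -/
def MenuConsistentPrimes : Prop :=
  ∀ (D : ℕ) [NeZero D] (χ : DirichletCharacter ℂ D), χ.IsPrimitive → χ.IsQuadratic → χ ≠ 1 →
    (43250 : ℝ) ≤ Real.log D → PrimeMenu (world D χ) (primeWorld D χ)

/-! ## 5. Proved bookkeeping -/

/-- Off the induced moduli the sign datum vanishes: `D ∤ q ⇒ s(q,a) = 0`. [cite: ThornerZaman2024PNTAP, Theorem 1 p.3] -/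
theorem siegelSign_of_not_dvd {D : ℕ} (χ : DirichletCharacter ℂ D) {q : ℕ} (h : ¬ D ∣ q) (a : ZMod q) :
    siegelSign D χ q a = 0 := by
  unfold siegelSign
  rw [dif_neg h]

/-- The sign datum is bounded: `|s(q,a)| ≤ 1` (a character value has norm `≤ 1`). [cite: ThornerZaman2024PNTAP, Theorem 1 p.3] -/
theorem abs_siegelSign_le (D : ℕ) (χ : DirichletCharacter ℂ D) (q : ℕ) (a : ZMod q) : |siegelSign D χ q a| ≤ 1 := by
  unfold siegelSign
  split_ifs with h
  · exact (Complex.abs_re_le_norm _).trans (DirichletCharacter.norm_le_one _ a)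
  · simp

/-- On a non-induced modulus the prime world is the plain main term: `θ_W(x;q,a,h) = (max(x,1) − max(x−h,1))/φ(q)` for
units `a`. [cite: ThornerZaman2024PNTAP, Theorem 1 p.3] -/
theorem primeWorld_theta_of_not_dvd {D : ℕ} (χ : DirichletCharacter ℂ D) {q : ℕ} (h : ¬ D ∣ q) {a : ZMod q}
    (ha : IsUnit a) (x h' : ℝ) :
    (primeWorld D χ).theta q a x h' = (max x 1 - max (x - h') 1) / Nat.totient q := by
  show (if IsUnit a then (∫ t in max (x - h') 1..max x 1, (1 - siegelSign D χ q a * t ^ (betaExc D - 1))) /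
      Nat.totient q else 0) = _
  rw [if_pos ha]
  simp [siegelSign_of_not_dvd χ h]

end Literature.NumberTheory.LFunctions.Zhang2022.DH

end
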